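import Summits.BirchSwinnertonDyer.Rank1Residual.Additive.XGordRankZeroCyclotomicPrimePrep
import Literature.NumberTheory.EllipticCurves.PAdicLFunctionPlusMultDistributionProofs
import Literature.NumberTheory.EllipticCurves.PAdicLFunctionMinusMultDistributionProofs
import HarnessLib

/-!
# Line V19b, preparation: the MIDDLE branch `L_p(V, ω^{(p−1)/2}, 0)` of the ONE-TERM measure at a
# MULTIPLICATIVE prime `p` (split or non-split) against `L(W,1)/Ω_W` for the twist `W ≅ V^{(p*)}`,
# both parities at once (cell `b2b-bsdres`, seat additive-p4)

HONEST FRAMING (cell `b2b-bsdres`, run/shared/lean/b2b/bsd-rank1-residual/, verbatim in every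
file): the goal of the cell is to DELETE the COMBINATION-SHAPED residual classes of the
Birch–Swinnerton-Dyer formula for ALL analytic-rank `≤ 1` elliptic curves over `ℚ` — "full BSD
formula for every rank `≤ 1` curve in class `C`" assembled STRICTLY from published theorems — so
that the rank-`≤ 1` remainder becomes exactly the CONSTRUCTION-SHAPED classes, which are TYPED
(missing-input `Prop`s), NOT attempted. This is not "finishing BSD". Seat additive-p4 (research route
on X3/X4); no label moves; nothing is booked here.

Theorems only (no `def`, no `sorry`, no named fact). The multiplicative twin of
`XGordRankZeroCyclotomicPrimePrep` (line V19): at a prime `p ∣ N` of multiplicative reduction the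
Mazur–Tate–Teitelbaum measure has ONE term (`ε(p) = 0`, allowable root `α = a_p ∈ {±1}`), its
`ω^i`-branches are the tree's `padicLFunctionPlusBranchMult f α i` (even `i`) /
`padicLFunctionMinusBranchMult f α i` (odd `i`), and the constant term of the MIDDLE branch
`i = (p−1)/2` is `α⁻¹ · ∑_{a mod p} (a/p)[a/p]^±_f` (`constantCoeff_padicLFunctionPlusBranchMult_half`,
`constantCoeff_padicLFunctionMinusBranchMult_half` below: the distribution law of the one-term measure,
tree `sum_fiber_msd{Plus,Minus}MeasureMult_succ_eq_of_coeffField`, and Euler's criterion for the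
Teichmüller character, tree `teichRep_pow_half_eq_legendreSym`). Birch + Pal for the twist by
`p* = ±p` (`entireLFunction_one_eq_of_twist_explicit` / `…_of_twist_neg`, tree theorems valid for ANY
globally minimal `V` with additive twist `W`) and `ord_p u(C) = 0` (`padicValRat_u_eq_zero_of_twist_pm_p`,
`V` multiplicative at `p`) then give ONE existential datum `(ϖ_mid, S, t_W)` consumed by the core
theorem of line V19b (`XMultRankZeroCyclotomicPrime.lean`): `B_mid(0) = α⁻¹S`, `L(W,1)/Ω_W = t_W ≠ 0`,
`S ≠ 0`, `ord_p t_W = ord_p ϖ_mid + ord_p S`, `ord_p ϖ_mid = ord_p ϖ` or `ord_p ϖ'` by parity.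

References: Mazur–Tate–Teitelbaum 1986 §I.10 (10.1) (`ε(p) = 0`), §I.13–I.14; V. Pal, Canad. Math.
Bull. 55 (2012) Thm. 3.2; B. J. Birch (twisted `L`-values by modular symbols), as in the tree files
cited above.
-/

noncomputable section

open scoped Classical MatrixGroups ModularForm

open CongruenceSubgroup WeierstrassCurve NumberField IsDedekindDomain
  Literature.NumberTheory.EllipticCurves Literature.NumberTheory.EllipticCurves.ModularForms
  Literature.NumberTheory.EllipticCurves.Rank1Residual
  Literature.NumberTheory.GaloisRepresentations

namespace Summit.BirchSwinnertonDyer.Rank1Residual.Additive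

/-! ## §1 The middle branches of the one-term measure at `T = 0` -/

section ConstantTerms

variable (p : ℕ) [hp : Fact p.Prime]

/-- **The EVEN `χ_p`-branch of the one-term measure at `T = 0` (PROVED).** For `p ≠ 2`, `p ∣ N`,
`f` a rational newform (`IsNewform0 f`, `coeffField f = ⊥`) with `a_p(f) = ap ≠ 0` in `ℚ_p`:
`constantCoeff (padicLFunctionPlusBranchMult f ap ((p−1)/2)) = ap⁻¹ · ∑_{a mod p} (a/p)·[a/p]⁺_f`
(`= ap⁻¹ · legendrePlusSymbolSum f p`). Proof: `constantCoeff_padicLFunctionPlusBranchMult_eq_sum`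
(constant term `= α⁻¹∑_{a ∈ (ℤ/p)ˣ} ω(a)^i[a/p]⁺`, granted the distribution law
`sum_fiber_msdPlusMeasureMult_succ_eq_of_coeffField`) and Euler's criterion
`ω(a)^{(p−1)/2} = (a/p)` (`teichRep_pow_half_eq_legendreSym`).
[cite: MazurTateTeitelbaum1986Invent, §I.10 (10.1) with ε(p) = 0, §I.13–I.14] -/
theorem constantCoeff_padicLFunctionPlusBranchMult_half (hp2 : p ≠ 2) {N : ℕ} [NeZero N]
    {f : CuspForm (Gamma0 N) 2} (hf : IsNewform0 f) (hQ : coeffField f = ⊥) (hpN : p ∣ N)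
    {ap : ℤ} (hap : cuspCoeff f p = ap) (hap0 : (ap : ℚ_[p]) ≠ 0) :
    PowerSeries.constantCoeff (padicLFunctionPlusBranchMult f (ap : ℚ_[p]) (p / 2)) =
      (ap : ℚ_[p])⁻¹ * (legendrePlusSymbolSum f p : ℚ_[p]) := by
  classical
  have hdist0 := sum_fiber_msdPlusMeasureMult_succ_eq_of_coeffField (p := p) hf hQ hpN hap hap0
  rw [constantCoeff_padicLFunctionPlusBranchMult_eq_sum hp2 hdist0 (p / 2)]
  congr 1
  have hsummand : ∀ a : (ZMod (p ^ cyclotomicExponent p))ˣ,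
      ((((teichRep p a : rootsOfUnity (torsionOrder p) ℤ_[p]) : ℤ_[p]ˣ) : ℤ_[p]) : ℚ_[p]) ^ (p / 2) *
          (ratPlusSymbol f (((a : ZMod (p ^ cyclotomicExponent p)).val : ℚ) / p) : ℚ_[p]) =
        (legendreSym p ((a : ZMod (p ^ cyclotomicExponent p)).val : ℤ) : ℚ_[p]) *
          (ratPlusSymbol f (((a : ZMod (p ^ cyclotomicExponent p)).val : ℚ) / p) : ℚ_[p]) := by
    intro a
    rw [← PadicInt.coe_pow, teichRep_pow_half_eq_legendreSym p hp2 a, PadicInt.coe_intCast]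
  rw [Fintype.sum_congr _ _ hsummand]
  rw [sum_units_cyclotomicExponent_eq p hp2
    (fun n : ℕ ↦ (legendreSym p (n : ℤ) : ℚ_[p]) * (ratPlusSymbol f ((n : ℚ) / p) : ℚ_[p]))
    (fun n hn ↦ by
      rw [(legendreSym.eq_zero_iff p (n : ℤ)).mpr (by exact_mod_cast (ZMod.natCast_eq_zero_iff n p).mpr hn)]
      push_cast
      ring)]
  rw [legendrePlusSymbolSum_def]
  push_cast
  rfl

/-- **The ODD `χ_p`-branch of the one-term measure at `T = 0` (PROVED).** For `p ≠ 2`, `p ∣ N`,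
`f` a rational newform with `a_p(f) = ap ≠ 0` in `ℚ_p`:
`constantCoeff (padicLFunctionMinusBranchMult f ap ((p−1)/2)) = ap⁻¹ · ∑_{a mod p} (a/p)·[a/p]⁻_f`
(`= ap⁻¹ · legendreMinusSymbolSum f p`). General-`ap` form of the tree's
`constantCoeff_padicLFunctionMinusBranchMult_half_of_nonsplit` / `…_of_split`.
[cite: MazurTateTeitelbaum1986Invent, §I.10 (10.1) with ε(p) = 0, §I.13–I.14] -/
theorem constantCoeff_padicLFunctionMinusBranchMult_half (hp2 : p ≠ 2) {N : ℕ} [NeZero N]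
    {f : CuspForm (Gamma0 N) 2} (hf : IsNewform0 f) (hQ : coeffField f = ⊥) (hpN : p ∣ N)
    {ap : ℤ} (hap : cuspCoeff f p = ap) (hap0 : (ap : ℚ_[p]) ≠ 0) :
    PowerSeries.constantCoeff (padicLFunctionMinusBranchMult f (ap : ℚ_[p]) (p / 2)) =
      (ap : ℚ_[p])⁻¹ * (legendreMinusSymbolSum f p : ℚ_[p]) := by
  classical
  have hdist0 := sum_fiber_msdMinusMeasureMult_succ_eq_of_coeffField (p := p) hf hQ hpN hap hap0
  rw [constantCoeff_padicLFunctionMinusBranchMult_eq hdist0 (p / 2)]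
  have hsummand : ∀ a : (ZMod (p ^ cyclotomicExponent p))ˣ,
      msdMinusMeasureMult f (ap : ℚ_[p]) (cyclotomicExponent p) (a : ZMod (p ^ cyclotomicExponent p)) *
          ((((teichRep p a : rootsOfUnity (torsionOrder p) ℤ_[p]) : ℤ_[p]ˣ) : ℤ_[p]) : ℚ_[p]) ^
            (p / 2) =
        (ap : ℚ_[p])⁻¹ * ((legendreSym p ((a : ZMod (p ^ cyclotomicExponent p)).val : ℤ) : ℚ_[p]) *
            (ratMinusSymbol f (((a : ZMod (p ^ cyclotomicExponent p)).val : ℚ) / p) : ℚ_[p])) := by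
    intro a
    have hteich : ((((teichRep p a : rootsOfUnity (torsionOrder p) ℤ_[p]) : ℤ_[p]ˣ) : ℤ_[p]) :
        ℚ_[p]) ^ (p / 2) =
        (legendreSym p ((a : ZMod (p ^ cyclotomicExponent p)).val : ℤ) : ℚ_[p]) := by
      rw [← PadicInt.coe_pow, teichRep_pow_half_eq_legendreSym p hp2 a, PadicInt.coe_intCast]
    have he : cyclotomicExponent p = 1 := cyclotomicExponent_eq_one p hp2
    have h1 : ((ap : ℚ_[p]))⁻¹ ^ cyclotomicExponent p = (ap : ℚ_[p])⁻¹ := by rw [he, pow_one]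
    have h2 : ((p : ℚ)) ^ cyclotomicExponent p = p := by rw [he, pow_one]
    rw [hteich, msdMinusMeasureMult, h1, h2]
    ring
  rw [Fintype.sum_congr _ _ hsummand, ← Finset.mul_sum]
  congr 1
  rw [sum_units_cyclotomicExponent_eq p hp2
    (fun n : ℕ ↦ (legendreSym p (n : ℤ) : ℚ_[p]) * (ratMinusSymbol f ((n : ℚ) / p) : ℚ_[p]))
    (fun n hn ↦ by
      rw [(legendreSym.eq_zero_iff p (n : ℤ)).mpr (by exact_mod_cast (ZMod.natCast_eq_zero_iff n p).mpr hn)]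
      push_cast
      ring)]
  rw [legendreMinusSymbolSum_def]
  push_cast
  rfl

end ConstantTerms

/-! ## §2 The middle-branch datum for a multiplicative `V` -/

section Prep

variable (p : ℕ) [hp : Fact p.Prime]
  (V : WeierstrassCurve ℚ) [V.IsElliptic] [V.IsGloballyMinimal]
  (W : WeierstrassCurve ℚ) [W.IsElliptic] [W.IsGloballyMinimal]

/-- **The middle-branch datum of line V19b (both parities, split or non-split).** For `p` odd,
`V/ℚ` globally minimal MULTIPLICATIVE at `p` with newform `f` of level `N`, `p ∣ N`,
`a_p(f) = ap ∈ {±1}`, `W = C • V^{(p*)}` globally minimal and additive at `p`, `ϖ·Ω_V = Ω⁺_f`,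
`ϖ'·|Ω⁻(V)| = Ω⁻_f`, `ϖ ≠ 0`, `L(W,1) ≠ 0`: there are rationals `ϖ_mid, S, t_W` with
`B_{(p−1)/2}(0) = ap⁻¹·S` (`B_i` the `ω^i`-branch of the ONE-TERM measure, plus/minus by the parity
of `i = (p−1)/2`), `L(W,1)/Ω_W = t_W`, `t_W ≠ 0`, `S ≠ 0`, `ord_p t_W = ord_p ϖ_mid + ord_p S`, and
`ord_p ϖ_mid = ord_p ϖ` (`p ≡ 1 (mod 4)`) resp. `ord_p ϖ'` (`p ≡ 3 (mod 4)`): Birch + Pal for the twist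
by `p* = ±p` (`entireLFunction_one_eq_of_twist_explicit` / `…_of_twist_neg`), the middle constant
terms (§1), `ord_p u(C) = 0` (`padicValRat_u_eq_zero_of_twist_pm_p`, multiplicative case).
[cite: MazurTateTeitelbaum1986Invent, §I.10, §I.13–I.14] [cite: Pal2012, Thm. 3.2] -/
theorem XMultCyclotomicPrime.exists_midBranch_datum (hmod : hasEntireLFunction_rat) (hp2 : p ≠ 2)
    (C : VariableChange ℚ) (hC : C • V.quadraticTwist ((-1 : ℚ) ^ (p / 2) * p) = W)
    (hmult : V.HasMultiplicativeReductionAtPrime p) (hadd : Addv W p)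
    {N : ℕ} [NeZero N] {f : CuspForm (Gamma0 N) 2} (hf : IsNewformOf V f) (hpN : p ∣ N)
    {ap : ℤ} (hap : cuspCoeff f p = ap) (hap1 : ap = 1 ∨ ap = -1)
    (ϖ ϖ' : ℚ) (hϖ : (ϖ : ℝ) * V.realPeriodRat = plusPeriod f)
    (hϖ' : (ϖ' : ℝ) * V.imaginaryPeriodRat = minusPeriod f) (hϖ0 : ϖ ≠ 0)
    (hLW : W.entireLFunction 1 ≠ 0) :
    ∃ ϖm S tW : ℚ,
      PowerSeries.constantCoeff
          (if Even (p / 2) then padicLFunctionPlusBranchMult f (ap : ℚ_[p]) (p / 2)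
            else padicLFunctionMinusBranchMult f (ap : ℚ_[p]) (p / 2)) =
        (ap : ℚ_[p])⁻¹ * ((S : ℚ) : ℚ_[p]) ∧
      W.entireLFunction 1 / (W.realPeriodRat : ℂ) = ((tW : ℚ) : ℂ) ∧ tW ≠ 0 ∧ S ≠ 0 ∧
      padicValRat p tW = padicValRat p ϖm + padicValRat p S ∧
      padicValRat p ϖm = (if p % 4 = 1 then padicValRat p ϖ else padicValRat p ϖ') := by
  classical
  haveI : NeZero p := ⟨hp.out.ne_zero⟩
  have hodd : p % 4 = 1 ∨ p % 4 = 3 := by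
    obtain ⟨k, hk⟩ := hp.out.odd_of_ne_two hp2
    omega
  have hap0 : (ap : ℚ_[p]) ≠ 0 := by
    rcases hap1 with h | h <;> rw [h] <;> norm_num
  set a : ℚ_[p] := (ap : ℚ_[p]) with ha
  set B : ℕ → PowerSeries ℚ_[p] := fun i ↦
    (if Even i then padicLFunctionPlusBranchMult f a i else padicLFunctionMinusBranchMult f a i) with hB
  show ∃ ϖm S tW : ℚ, PowerSeries.constantCoeff (B (p / 2)) = a⁻¹ * ((S : ℚ) : ℚ_[p]) ∧ _
  -- `ord_p u(C) = 0`
  have hvuC : padicValRat p |(C.u : ℚ)| = 0 := by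
    have hu0 : padicValRat p (C.u : ℚ) = 0 := by
      rcases hodd with h1 | h3
      · have hC3 : C • V.quadraticTwist ((((p : ℕ) : ℤ)) : ℚ) = W := by
          rw [pStar_eq_of_mod_four p (Or.inl h1), if_pos h1] at hC
          push_cast; exact hC
        exact padicValRat_u_eq_zero_of_twist_pm_p p hp2 V W (Or.inr hmult) (Or.inl rfl) C hC3
      · have hC3 : C • V.quadraticTwist (((-((p : ℕ) : ℤ)) : ℤ) : ℚ) = W := by
          rw [pStar_eq_of_mod_four p (Or.inr h3), if_neg (by omega)] at hC
          push_cast; exact hC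
        exact padicValRat_u_eq_zero_of_twist_pm_p p hp2 V W (Or.inr hmult) (Or.inr rfl) C hC3
    rcases abs_choice (C.u : ℚ) with h' | h'
    · rw [h', hu0]
    · rw [h', padicValRat.neg, hu0]
  have hua0 : |(C.u : ℚ)| ≠ 0 := abs_ne_zero.mpr C.u.ne_zero
  have hΩW : (W.realPeriodRat : ℂ) ≠ 0 := by exact_mod_cast W.realPeriodRat_pos_holds.ne'
  rcases hodd with h1 | h3
  · -- `p ≡ 1 (mod 4)`: even middle branch, Birch + Pal with `Ω⁺`
    have heven : Even (p / 2) := by rw [Nat.even_iff]; omega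
    have hC' : C • V.quadraticTwist (p : ℚ) = W := by
      rw [pStar_eq_of_mod_four p (Or.inl h1), if_pos h1] at hC
      exact hC
    obtain ⟨ε, hε, hLW_eq⟩ :=
      entireLFunction_one_eq_of_twist_explicit p hmod h1 V W C hC' hadd hf ϖ hϖ
    have hε0 : ε ≠ 0 := by rcases hε with h | h <;> rw [h] <;> norm_num
    have hvε : padicValRat p ε = 0 := by
      rcases hε with h | h
      · rw [h, padicValRat.one]
      · rw [h, padicValRat.neg, padicValRat.one]
    have hnum0 : ε * (ϖ * legendrePlusSymbolSum f p) ≠ 0 := by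
      intro h0
      apply hLW
      rw [hLW_eq, h0, zero_div, Rat.cast_zero, zero_mul]
    have hϖS : ϖ * legendrePlusSymbolSum f p ≠ 0 := fun h0 ↦ hnum0 (by rw [h0, mul_zero])
    have hS0 : legendrePlusSymbolSum f p ≠ 0 := fun h0 ↦ hϖS (by rw [h0, mul_zero])
    refine ⟨ϖ, legendrePlusSymbolSum f p, ε * (ϖ * legendrePlusSymbolSum f p) / |(C.u : ℚ)|,
      ?_, ?_, div_ne_zero hnum0 hua0, hS0, ?_, by rw [if_pos h1]⟩
    · have hb : B (p / 2) = padicLFunctionPlusBranchMult f a (p / 2) := by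
        simp only [hB, if_pos heven]
      rw [hb, ha]
      exact constantCoeff_padicLFunctionPlusBranchMult_half p hp2 hf.1 hf.coeffField_eq_bot hpN hap
        hap0
    · rw [hLW_eq, mul_div_cancel_right₀ _ hΩW]
    · rw [padicValRat.div hnum0 hua0, padicValRat.mul hε0 hϖS, padicValRat.mul hϖ0 hS0, hvε, hvuC]
      ring
  · -- `p ≡ 3 (mod 4)`: odd middle branch, odd Birch + Pal with `|Ω⁻|`
    have hoddm : ¬ Even (p / 2) := by rw [Nat.not_even_iff]; omega
    have hC' : C • V.quadraticTwist (-(p : ℚ)) = W := by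
      rw [pStar_eq_of_mod_four p (Or.inr h3), if_neg (by omega)] at hC
      exact hC
    obtain ⟨ε, hε, hLW_eq⟩ :=
      entireLFunction_one_eq_of_twist_neg p hmod h3 V W C hC' hadd hf ϖ' hϖ'
    set cinf : ℕ := (W.baseChange ℝ).numRealComponents with hcinf
    have hε0 : ε ≠ 0 := by rcases hε with h | h <;> rw [h] <;> norm_num
    have hvε : padicValRat p ε = 0 := by
      rcases hε with h | h
      · rw [h, padicValRat.one]
      · rw [h, padicValRat.neg, padicValRat.one]
    have hcinf0 : (cinf : ℚ) ≠ 0 := by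
      rw [hcinf, numRealComponents]
      split_ifs <;> norm_num
    have hden0 : |(C.u : ℚ)| * (cinf : ℚ) ≠ 0 := mul_ne_zero hua0 hcinf0
    have hnum0 : ε * (ϖ' * legendreMinusSymbolSum f p) ≠ 0 := by
      intro h0
      apply hLW
      rw [hLW_eq, h0, zero_div, Rat.cast_zero, zero_mul]
    have hϖS : ϖ' * legendreMinusSymbolSum f p ≠ 0 := fun h0 ↦ hnum0 (by rw [h0, mul_zero])
    have hϖ'0 : ϖ' ≠ 0 := fun h0 ↦ hϖS (by rw [h0, zero_mul])
    have hS0 : legendreMinusSymbolSum f p ≠ 0 := fun h0 ↦ hϖS (by rw [h0, mul_zero])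
    refine ⟨ϖ', legendreMinusSymbolSum f p,
      ε * (ϖ' * legendreMinusSymbolSum f p) / (|(C.u : ℚ)| * (cinf : ℚ)), ?_, ?_,
      div_ne_zero hnum0 hden0, hS0, ?_, by rw [if_neg (by omega)]⟩
    · have hb : B (p / 2) = padicLFunctionMinusBranchMult f a (p / 2) := by
        simp only [hB, if_neg hoddm]
      rw [hb, ha]
      exact constantCoeff_padicLFunctionMinusBranchMult_half p hp2 hf.1 hf.coeffField_eq_bot hpN hap
        hap0
    · rw [hLW_eq, mul_div_cancel_right₀ _ hΩW]
    · rw [padicValRat.div hnum0 hden0, padicValRat.mul hε0 hϖS, padicValRat.mul hϖ'0 hS0, hvε,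
        padicValRat.mul hua0 hcinf0, hvuC, hcinf, padicValRat_numRealComponents_eq_zero W p hp2]
      ring

end Prep

end Summit.BirchSwinnertonDyer.Rank1Residual.Additive

end
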